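import Mathlib
import HarnessLib
import Summits.Parity.Statement
import Summits.Parity.GeneralizedHardyLittlewood.Theses.ConstellationCubes

/-!
# Assembly of route-Parity-ConstellationCubes (item stmt-Parity-28873)

`Assembly : BoundedSiegelZeroQuality → UniformUpperGivenFixed → UniformLowerGivenFixed → CubeTransference → CubeHL → GeneralizedHardyLittlewood` is literally the route's certified deciding theorem `closes`
(node G1.2.F «ConstellationCubes» (decomp-parity lens-4 g4; normal form beneath the record's fixed-pattern leaves FU ∧ FL; rev 1)): CubeHL and the transference give FU ∧ FL, which with Q and the two uniform residuals re-assemble GHL through the record's closes.  One line; no mathematics beyond the route file.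
-/

namespace Summit.Parity.GeneralizedHardyLittlewood.Theses.ConstellationCubes

/-- Assembly item stmt-Parity-28873 of route-Parity-ConstellationCubes:
`BoundedSiegelZeroQuality → UniformUpperGivenFixed → UniformLowerGivenFixed → CubeTransference → CubeHL → GeneralizedHardyLittlewood`,
by the route's deciding theorem `closes`. -/
theorem assembly_proof : Assembly :=
  fun h1 h2 h3 h4 h5 => closes h1 h2 h3 h4 h5

end Summit.Parity.GeneralizedHardyLittlewood.Theses.ConstellationCubes
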